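import Literature.Analysis.FluidPDE.RusinSverakLerayStabilityProofs
import Literature.Analysis.FluidPDE.RusinSverakSingularityStabilityEpsilon
import Literature.Analysis.FluidPDE.CKNOneScaleFromRRS
import HarnessLib

/-!
# Rusin–Šverák's stability of singular points (**S**) over the live leaves of its decomposition

Analysis/FluidPDE proof file (no new definitions, no new named facts) for the named fact
`Literature.Analysis.FluidPDE.rusin_sverak_leray_singular_points_stable` (**S**;
`RusinSverakLeraySolutions.lean`; W. Rusin, V. Šverák, *Minimal initial data for potential
Navier–Stokes singularities*, J. Funct. Anal. 260 (2011) 879–891 = arXiv:0911.0500, **Thm. 4.2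
with Lemma 2.1**, as used in the proof of Cor. 4.2, p. 8: "Apply the theorem, together with
Lemma 4.1, Proposition 2.2 and Lemma 2.1": Leray solutions `(u^k, p^k) ∈ NS(v₀^k)` with data
bounded and weakly convergent in `Ḣ^{1/2}` and singular points `(T, x_k)`, `x_k → x_∞`, yield
a Leray solution of the weak-limit datum which is singular at `(T, x_∞)`).

State of the decomposition (accepted files): **S** ⇐ **K** ∧ **L** ∧ **B**
(`rusin_sverak_leray_singular_points_stable_of_weak_stability`, `RusinSverakLerayStability.lean`);
**L**, **B** ⇐ the pressure decay estimate — now the theorem `seregin_sverak_pressure_decay_holds`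
(`PressureDecayEstimateProofs.lean`; a second proof is `seregin_sverak_pressure_decay_of_stein`,
`PressureEquationSlicing.lean`) — ∧ a one-scale ε-regularity criterion
(`RusinSverakBackwardRegularity.lean`, `RusinSverakSingularityStability.lean`,
`RusinSverakSingularityStabilityEpsilon.lean`), the latter supplied by `oneScaleRegularity`,
which follows from Robinson–Rodrigo–Sadowski's Thm. 15.3 with force
(`oneScaleRegularity_of_theorem15_3_force`, `CKNOneScaleFromRRS.lean`), itself reduced to the two
named facts `RRS2016.step2_force`, `RRS2016.lemma15_12` (`RRS2016.theorem15_3_force_of_step2`,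
`CKNLocalRegularityRRSStep3.lean`); **K** ⇐ **K₃**
(`rusin_sverak_leray_weak_stability_of_jia_sverak`, `RusinSverakLerayStabilityProofs.lean`) ⇐ the three named facts `jia_sverak_2013_corollary_1`,
`jia_sverak_2013_lemma_8`, `localLeray_limiting_procedure` (`JiaSverak2013Compactness.lean`).

This file records the composite in one statement:

* `rusin_sverak_leray_singular_points_stable_of_leaves : jia_sverak_2013_corollary_1 →
  jia_sverak_2013_lemma_8 → localLeray_limiting_procedure → RRS2016.step2_force →
  RRS2016.lemma15_12 → rusin_sverak_leray_singular_points_stable`,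

so that the trust base of **S** is exactly these five printed results (Jia–Šverák 2013, Cor. 1
and Lemma 8; the local Leray limiting procedure of Lemarié-Rieusset / Kikuchi–Seregin /
Kang–Miura–Tsai; Robinson–Rodrigo–Sadowski 2016, Step 2 of the proof of Thm. 15.3 and
Lemma 15.12), each the target of an ongoing decomposition; `_holds` of **S** is their
composition with this theorem.

## References

* W. Rusin, V. Šverák, J. Funct. Anal. 260 (2011) 879–891 = arXiv:0911.0500, Lemma 2.1,
  Prop. 2.2, Lemma 4.1, Thm. 4.2, proof of Cor. 4.2 (p. 8). [RusinSverak2011]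
* H. Jia, V. Šverák, SIAM J. Math. Anal. 45 (2013) = arXiv:1201.1592, Cor. 1, Lemmas 5–8.
* J. C. Robinson, J. L. Rodrigo, W. Sadowski, *The three-dimensional Navier–Stokes equations*
  (2016), Thm. 15.3, Lemma 15.12.
-/

noncomputable section

namespace Literature.Analysis.FluidPDE

/-- **S over the live leaves.** Rusin–Šverák's stability of singular points
(`rusin_sverak_leray_singular_points_stable`, Thm. 4.2 with Lemma 2.1) follows from
Jia–Šverák's Cor. 1 and Lemma 8, the local Leray limiting procedure, and the two remaining
named facts of the Robinson–Rodrigo–Sadowski route to the one-scale ε-regularity criterion: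
**K** by `rusin_sverak_leray_weak_stability_of_facts`, the ε-regularity input by
`oneScaleRegularity_of_theorem15_3_force ∘ RRS2016.theorem15_3_force_of_step2`, the pressure
decay estimate being a theorem (`rusin_sverak_leray_singular_points_stable_of_oneScaleRegularity`).
[cite: RusinSverak2011, Thm. 4.2 with Lemma 2.1, proof of Cor. 4.2 (arXiv:0911.0500 pp. 4, 7–8)] -/
theorem rusin_sverak_leray_singular_points_stable_of_leaves
    (h1 : jia_sverak_2013_corollary_1) (h8 : jia_sverak_2013_lemma_8)
    (hlim : localLeray_limiting_procedure)
    (h2 : RRS2016.step2_force) (h12 : RRS2016.lemma15_12) :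
    rusin_sverak_leray_singular_points_stable :=
  rusin_sverak_leray_singular_points_stable_of_oneScaleRegularity
    (rusin_sverak_leray_weak_stability_of_facts h1 h8 hlim)
    (oneScaleRegularity_of_theorem15_3_force (RRS2016.theorem15_3_force_of_step2 h2 h12))

end Literature.Analysis.FluidPDE

end
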